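import Mathlib
import Summits.Ventures.PercRepro2.SwOutBridge

/-!
# Instances of the bridge junctions (blind cell PercRepro2, night-4 g28, 2026-08-28;
proofs/NIGHT4-G28.md §3)

* `ex6` — `l = 1`, `h = 0`, `o = 2` on the 6-vertex graph `0–5, 1–3, 1–5, 2–4, 2–5, 3–4, 3–5, 4–5`
  (an uncovered pair of the junction lane at `n = 6`: the junction `4` has the non-`h`-adjacent
  neighbours `o, 3` in the component `{2, 3, 5}` of `G[U ∖ {h, u}]` containing the `h`-neighbour
  `5` — a MIXED component with two dropped vertices sharing an `h`-piece, the mark dropped);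
  `h` has the single edge `0–5`: **`sw_ex6 : Sw ex6 1 0 2`** by `sw_of_degree_le_one`.
* `ex8` — `l = 0`, `h = 1`, `o = 2`; `h` adjacent to `3, 4` (joined to `l`); the edge `4–5` is a
  bridge of `G − l` (not of `G`: `5` reaches `l` through `o` and through `6–7`) behind which the
  two junctions `5, 6` (adjacent to each other, not to `h`) and the mark sit:
  **`sw_ex8 : Sw ex8 0 1 2`** by `sw_of_bridges`.
-/

namespace Summit.Ventures.PercRepro2

namespace LocRows

open Hull

open scoped Classical

/-- `h = 0` of degree one: edges `0–5, 1–3, 1–5, 2–4, 2–5, 3–4, 3–5, 4–5`. -/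
def ex6 : Fin 8 → Sym2 (Fin 6)
  | 0 => s(0, 5) | 1 => s(1, 3) | 2 => s(1, 5) | 3 => s(2, 4) | 4 => s(2, 5) | 5 => s(3, 4)
  | 6 => s(3, 5) | 7 => s(4, 5)

/-- **Row (SW) on `ex6`** with `l = 1`, `h = 0`, `o = 2`: `h` carries one edge. -/
theorem sw_ex6 : Sw ex6 1 0 2 := by
  refine sw_of_degree_le_one (by decide) ?_ ?_
  · intro e; fin_cases e <;> decide
  · intro e e' he he'
    fin_cases e <;> fin_cases e' <;> simp [ex6] at he he' ⊢

/-- The bridge `4–5` of `G − l`: `l = 0`, `h = 1`, `o = 2`, the junctions `5, 6`. -/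
def ex8 : Fin 12 → Sym2 (Fin 8)
  | 0 => s(1, 3) | 1 => s(1, 4) | 2 => s(3, 0) | 3 => s(4, 0) | 4 => s(3, 4) | 5 => s(4, 5)
  | 6 => s(5, 6) | 7 => s(5, 2) | 8 => s(6, 7) | 9 => s(7, 0) | 10 => s(2, 0) | 11 => s(6, 2)

/-- In `G − l` without the edge `4–5`, the component of `h = 1` is `{1, 3, 4}`. -/
lemma ex8_cluster_cut : cluster ex8 (cutConfig ex8 ({0}ᶜ) 5) 1 ⊆ {1, 3, 4} := by
  refine cluster_cut_subset (by simp) ?_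
  intro e x y hexy hin hne hx
  simp only [Set.mem_insert_iff, Set.mem_singleton_iff] at hx ⊢
  obtain ⟨a, ha, b, hb, hab⟩ := hin
  simp only [Set.mem_compl_iff, Set.mem_singleton_iff] at ha hb
  fin_cases e
  all_goals simp only [ex8, Sym2.eq_iff] at hexy hab
  all_goals first | exact absurd rfl hne | omega

/-- **Row (SW) on `ex8`**: the junctions `5, 6` are separated from `h` by the bridge `4–5` of
`G − l`. -/
theorem sw_ex8 : Sw ex8 0 1 2 := by
  refine sw_of_bridges (by decide) ?_ ?_
  · intro e; fin_cases e <;> decide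
  · intro x hx0 hx1 hx2
    fin_cases x
    · exact absurd rfl hx0
    · exact absurd rfl hx1
    · exact absurd rfl hx2
    · exact Or.inl ⟨2, rfl⟩
    · exact Or.inl ⟨3, rfl⟩
    · refine Or.inr (Or.inr ⟨5, fun h => ?_⟩)
      have := ex8_cluster_cut h
      simp at this
    · refine Or.inr (Or.inr ⟨5, fun h => ?_⟩)
      have := ex8_cluster_cut h
      simp at this
    · exact Or.inl ⟨9, rfl⟩

end LocRows

end Summit.Ventures.PercRepro2
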